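import Mathlib
import HarnessLib
import Summits.HubbardSuperconductivity.HubbardSuperconductivity.Theorems.KLProgrammeKLRegimeAlphaWtRegime
import Summits.HubbardSuperconductivity.HubbardSuperconductivity.Theorems.KLProgrammeKLRegimeSectorMultiplierOverlapWtFlow
import Summits.HubbardSuperconductivity.HubbardSuperconductivity.Theorems.KLProgrammeKLRegimeEngineFlowPieceIncrementData

/-!
# K3 ENGINE child (stmt-HubbardSuperconductivity-20437), stub (b): **`α_w` AT THE FLOW FRAME `K_n`** — the `klScaleWt`-weighted `hrow/hcol` of
# `EngineV8.klNormsStepWt_of_sliceConsts` (`S(F̃_nf)ᵀ·klSliceCov (nf+j)·S(F̃_nf)`, weight scale `nw ≥ nf + j`) under the binders of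
# `E4FlowAt` / `stub_engine_step_norms`, ONE constant per `(j, d)` (`n + 2 ≤ 2·nf + d`)

Cell `gate-hubbard-kl`, seat p3 (g10); program «W3α = α_w rows instance», final file (α4-flow): the order-three frame data of
`alphaWt_klSliceCov_bgmFat_of_thresholds` are discharged from the history — `frameOK_klFlowFrameU_succ` + `frameShift_high_sizes_of_frameOK`
(`‖D³(frameShift K_n)‖ ≤ Gfr₃U²4ⁿ/3`) and `norm_iteratedFDeriv_frameLevel_klFlowFrameU_le` (`‖D³e_{K_n}‖ ≤ 64 + Gfr₃U²·Σ_{m<n}4^m`), so that with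
`U ≤ 1/(Gfr₃+1)` and `n + 2 ≤ 2·nf + d`: `A₃Λ_{nf−1}² ≤ 4^d/3072` and `K₃Λ_{nf+j}² ≤ 1/16 + 4^d/3072` (FINDING «W2-HALF»: n-free near the top).

* **`alphaWt_klSliceCov_bgmFat_klEng_flow (j d)`** — `∃ Cα > 0`: for every `G P R Q cc` (`R.WF2`, `0 < cc ≤ klEngC₃6 P R`), `μ ∈ klWindowC`,
  `0 < U ≤ min (klEngU₀3 P R cc) (1/(Gfr₃+1))`, `klBetaMin ≤ β ≤ e^{cc/U²}`, `klEngL₃ β U ≤ L`, `klEngM₃ β U L ≤ M`, `1 ≤ n ≤ n_β + 1`,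
  `HistP klPredsV17F2 … 0 n`, `FrameOK R U n_β μ K_n`, every `1 ≤ nf` with `nf + j ≤ n_β + 1`, `n + 2 ≤ 2·nf + d`, `nf + j ≤ nw`:
  the weighted row and column sums are `≤ Cα·(M/β)/klScale klE0 (nf+j)`.  The door (fat `k`, slice `k+2`, `nw = k+2 = n`) reads `j = 2`, `d ≥ 4 − k`.

Everything is proved; no definitions. [cite: BenfattoGiulianiMastropietro2006, §2.8 (2.81), §3 (3.3)]
-/

noncomputable section

namespace Summit.HubbardSuperconductivity.HubbardSuperconductivity.Theorems.TorusFourierL2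

set_option linter.dupNamespace false -- summit = problem name (single-conjunct summit), D-0017

open Set Finset Literature.MathematicalPhysics.QuantumLattice Literature.MathematicalPhysics.QuantumLattice.BandSectorCounting
open Literature.MathematicalPhysics.QuantumLattice.FermiRG Literature.Probability.LatticeModels Literature.Analysis.SpecialFunctions
open Summit.HubbardSuperconductivity.HubbardSuperconductivity.Theorems.DispersionFlow
open Summit.HubbardSuperconductivity.HubbardSuperconductivity.Theorems.KLRegimeSplit
open Summit.HubbardSuperconductivity.HubbardSuperconductivity.Theorems.KLProgrammeLegKernels
open Summit.HubbardSuperconductivity.HubbardSuperconductivity.Theorems.PerturbedFermiCurve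
open Summit.HubbardSuperconductivity.HubbardSuperconductivity.Theorems.KLRegimeWick
open Summit.HubbardSuperconductivity.HubbardSuperconductivity.Theorems.EngineV8
open scoped Real Nat

open Classical

set_option maxHeartbeats 1600000 in -- long regime bookkeeping
/-- **`α_w` at the flow frame, in the KL regime** (see the module docstring). [cite: BenfattoGiulianiMastropietro2006, §2.8 (2.81), §3 (3.3)] -/
theorem alphaWt_klSliceCov_bgmFat_klEng_flow (j dd : ℕ) :
    ∃ Cα : ℝ, 0 < Cα ∧
      ∀ (G : GeoConsts) (P : SplitConsts) (R : RenConsts) (Q : EngConsts) (cc : ℝ), R.WF2 → 0 < cc → cc ≤ EngineV8.klEngC₃6 P R →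
      ∀ μ ∈ klWindowC, ∀ U : ℝ, 0 < U → U ≤ min (EngineV8.klEngU₀3 P R cc) (1 / (R.Gfr 3 + 1)) →
      ∀ β : ℝ, klBetaMin ≤ β → β ≤ Real.exp (cc / U ^ 2) →
      ∀ (L M : ℕ) [NeZero L] [NeZero M], EngineV8.klEngL₃ β U ≤ L → EngineV8.klEngM₃ β U L ≤ M →
      ∀ n : ℕ, 1 ≤ n → n ≤ nScales β + 1 →
        HistP klPredsV17F2 L M G P Q R β U μ 0 n → FrameOK R U (nScales β) μ (klFlowFrameU L M β U μ n) →
        ∀ nf : ℕ, 1 ≤ nf → nf + j ≤ nScales β + 1 → n + 2 ≤ 2 * nf + dd → ∀ nw : ℕ, nf + j ≤ nw →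
        (∀ Y : SpaceTimeIdx L M × SectorLeg (sectorCount nf),
          ∑ Y', ‖((sectorSubMatrix L M β (bgmFatMultiplier L M klE0 β (nambuXiCT L μ (klFlowFrameU L M β U μ n)) nf)).transpose *
            klSliceCov L M β μ (klFlowFrameU L M β U μ n) (nf + j) *
            sectorSubMatrix L M β (bgmFatMultiplier L M klE0 β (nambuXiCT L μ (klFlowFrameU L M β U μ n)) nf)) Y Y'‖ *
              EngineV8.klScaleWt L M β nw {EngineV8.latticeLegPos (2 * (2 * M)) Y, EngineV8.latticeLegPos (2 * (2 * M)) Y'} ≤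
            Cα * ((M : ℝ) / β) / klScale klE0 (nf + j)) ∧
        (∀ Y' : SpaceTimeIdx L M × SectorLeg (sectorCount nf),
          ∑ Y, ‖((sectorSubMatrix L M β (bgmFatMultiplier L M klE0 β (nambuXiCT L μ (klFlowFrameU L M β U μ n)) nf)).transpose *
            klSliceCov L M β μ (klFlowFrameU L M β U μ n) (nf + j) *
            sectorSubMatrix L M β (bgmFatMultiplier L M klE0 β (nambuXiCT L μ (klFlowFrameU L M β U μ n)) nf)) Y Y'‖ *
              EngineV8.klScaleWt L M β nw {EngineV8.latticeLegPos (2 * (2 * M)) Y, EngineV8.latticeLegPos (2 * (2 * M)) Y'} ≤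
            Cα * ((M : ℝ) / β) / klScale klE0 (nf + j)) := by
  have ha : (-4 : ℝ) < -(6 / 5) := by norm_num
  have hab : (-(6 / 5) : ℝ) ≤ -(1 / 10) := by norm_num
  have hb : (-(1 / 10) : ℝ) < 0 := by norm_num
  obtain ⟨Cα, hCα, h⟩ := alphaWt_klSliceCov_bgmFat_of_thresholds ha hab hb j ((4 : ℝ) ^ dd / 3072) (1 / 16 + (4 : ℝ) ^ dd / 3072)
  refine ⟨Cα, hCα, ?_⟩
  intro G P R Q cc hR2 hcc hcc6 μ hμ U hU hUle β hβmin hβc L M _ _ hL3 hM3 n hn1 hnN hhist hfr nf hnf hnfN hwin nw hnw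
  have hRj : ∀ i, 0 ≤ R.Gfr i := EngineV8.gfr_nonneg_of_wf2 hR2
  have hcle := (hcc6.trans (EngineV8.klEngC₃6_le_klEngC₃3 P R)).trans (EngineV8.klEngC₃3_le_symbolC₃ ha hab hb P hRj)
  have hU3 := (hUle.trans (min_le_left _ _)).trans (EngineV8.klEngU₀3_le_symbolU₀ ha hab hb P hRj cc)
  have hU1 : U ≤ 1 := hU3.trans (min_le_left _ _)
  have hUG : U ≤ 1 / (R.Gfr 3 + 1) := hUle.trans (min_le_right _ _)
  have hLβ : β ^ 2 ≤ (L : ℝ) := EngineV8.sq_le_of_klEngL₃_le hL3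
  have hMβ : β ≤ (M : ℝ) := EngineV8.le_of_klEngM₃_le hβmin hL3 hM3
  set K : TrigPolyC4v := klFlowFrameU L M β U μ n with hKdef
  -- the order-three data of the flow frame from the history's (I-F jets)
  obtain ⟨N, rfl⟩ : ∃ N, n = N + 1 := ⟨n - 1, by omega⟩
  have hh := (histP_klPredsV17F2_iff L M G P Q R β U μ 0 (N + 1)).1 hhist
  have hJets : ∀ m ≤ N, FlowPieceJetsAt L M β U μ R m := fun m hm => (hh m (Nat.lt_succ_of_le hm)).2.1.2.1
  have hJets' : ∀ m < N + 1, FlowPieceJetsAt L M β U μ R m := fun m hm => hJets m (Nat.le_of_lt_succ hm)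
  have hGeo : FlowGeometryAt L M β U μ N := (hh N (Nat.lt_succ_self N)).2.1.2.2
  have hK1 : FrameOK R U N μ K := frameOK_klFlowFrameU_succ hJets hGeo
  have hA3 : ∀ p : Momentum, ‖iteratedFDeriv ℝ 3 (frameShift K) p‖ ≤ R.Gfr 3 * U ^ 2 * ((4 : ℝ) ^ (N + 1) / 3) :=
    (frameShift_high_sizes_of_frameOK hRj hK1).1
  have hGU : R.Gfr 3 * U ^ 2 ≤ 1 := by
    have hG3 := hRj 3
    have h1 : R.Gfr 3 * U ≤ 1 :=
      calc R.Gfr 3 * U ≤ R.Gfr 3 * (1 / (R.Gfr 3 + 1)) := mul_le_mul_of_nonneg_left hUG hG3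
        _ = R.Gfr 3 / (R.Gfr 3 + 1) := by ring
        _ ≤ 1 := by rw [div_le_one (by positivity)]; linarith only [hG3]
    calc R.Gfr 3 * U ^ 2 = (R.Gfr 3 * U) * U := by ring
      _ ≤ 1 * 1 := mul_le_mul h1 hU1 hU.le zero_le_one
      _ = 1 := by ring
  -- the geometric sum of the band third-derivative bound
  have hsum : ∑ m' ∈ range (N + 1), R.Gfr 3 * uPow 3 U * (4 : ℝ) ^ ((((3 : ℕ) : ℤ) - 2) * m') ≤ R.Gfr 3 * U ^ 2 * ((4 : ℝ) ^ (N + 1) / 3) := by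
    have e3 : uPow 3 U = U ^ 2 := by rw [show (3 : ℕ) = 2 + 1 by rfl, uPow_succ]
    have hterm : ∀ m' : ℕ, (4 : ℝ) ^ ((((3 : ℕ) : ℤ) - 2) * (m' : ℤ)) = (4 : ℝ) ^ m' := by
      intro m'
      rw [show (((3 : ℕ) : ℤ) - 2) * (m' : ℤ) = ((m' : ℕ) : ℤ) by push_cast; ring, zpow_natCast]
    have hgeom : ∀ k : ℕ, ∑ m' ∈ range k, (4 : ℝ) ^ m' ≤ (4 : ℝ) ^ k / 3 := by
      intro k
      induction k with
      | zero => simp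
      | succ k ih => rw [Finset.sum_range_succ, pow_succ]; linarith
    calc ∑ m' ∈ range (N + 1), R.Gfr 3 * uPow 3 U * (4 : ℝ) ^ ((((3 : ℕ) : ℤ) - 2) * m')
        = R.Gfr 3 * U ^ 2 * ∑ m' ∈ range (N + 1), (4 : ℝ) ^ m' := by
          rw [Finset.mul_sum]; exact Finset.sum_congr rfl fun m' _ => by rw [e3, hterm]
      _ ≤ R.Gfr 3 * U ^ 2 * ((4 : ℝ) ^ (N + 1) / 3) := mul_le_mul_of_nonneg_left (hgeom (N + 1)) (by have := hRj 3; positivity)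
  have hK3 : ∀ p : Momentum, ‖iteratedFDeriv ℝ 3 (frameLevel μ K) p‖ ≤ 64 + R.Gfr 3 * U ^ 2 * ((4 : ℝ) ^ (N + 1) / 3) := by
    intro p
    have h0 := norm_iteratedFDeriv_frameLevel_klFlowFrameU_le (L := L) (M := M) (β := β) (U := U) (μ := μ) (i := 3) (by norm_num) (by norm_num)
      hJets' p
    have e64 : (4 : ℝ) ^ (3 : ℕ) = 64 := by norm_num
    rw [e64] at h0
    exact h0.trans (by linarith only [hsum])
  -- the data on the window `n + 2 ≤ 2·nf + dd`
  have hdatA : R.Gfr 3 * U ^ 2 * ((4 : ℝ) ^ (N + 1) / 3) * klScale klE0 (nf - 1) ^ 2 ≤ (4 : ℝ) ^ dd / 3072 := by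
    have hΛm : klScale klE0 (nf - 1) = (1 / 32) * ((4 : ℝ) ^ (nf - 1))⁻¹ := by rw [klScale, klE0]
    have hpow : (4 : ℝ) ^ (N + 1) ≤ (4 : ℝ) ^ dd * ((4 : ℝ) ^ (nf - 1)) ^ 2 := by
      rw [← pow_mul, ← pow_add]
      exact pow_le_pow_right₀ (by norm_num) (by omega)
    rw [hΛm]
    have e : R.Gfr 3 * U ^ 2 * ((4 : ℝ) ^ (N + 1) / 3) * ((1 / 32) * ((4 : ℝ) ^ (nf - 1))⁻¹) ^ 2 =
        (R.Gfr 3 * U ^ 2) * ((4 : ℝ) ^ (N + 1) / ((4 : ℝ) ^ (nf - 1)) ^ 2) / 3072 := by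
      field_simp
      ring
    rw [e]
    have h2 : (4 : ℝ) ^ (N + 1) / ((4 : ℝ) ^ (nf - 1)) ^ 2 ≤ (4 : ℝ) ^ dd := by rw [div_le_iff₀ (by positivity)]; exact hpow
    have h3 : (R.Gfr 3 * U ^ 2) * ((4 : ℝ) ^ (N + 1) / ((4 : ℝ) ^ (nf - 1)) ^ 2) ≤ 1 * (4 : ℝ) ^ dd :=
      mul_le_mul hGU h2 (by positivity) zero_le_one
    linarith only [h3]
  have hdatK : (64 + R.Gfr 3 * U ^ 2 * ((4 : ℝ) ^ (N + 1) / 3)) * klScale klE0 (nf + j) ^ 2 ≤ 1 / 16 + (4 : ℝ) ^ dd / 3072 := by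
    have hΛle : klScale klE0 (nf + j) ≤ klScale klE0 (nf - 1) := EngineV8.klScale_le_klScale (by norm_num [klE0]) (by omega)
    have hΛe : klScale klE0 (nf + j) ≤ 1 / 32 := by
      have := klScale_le_e0 (show (0 : ℝ) ≤ klE0 by norm_num [klE0]) (nf + j); rwa [show klE0 = 1 / 32 from rfl] at this
    have hΛ0 : 0 ≤ klScale klE0 (nf + j) := (klth_klScale_pos _).le
    have h1 : 64 * klScale klE0 (nf + j) ^ 2 ≤ 1 / 16 := by nlinarith [hΛe, hΛ0]
    have h2 : R.Gfr 3 * U ^ 2 * ((4 : ℝ) ^ (N + 1) / 3) * klScale klE0 (nf + j) ^ 2 ≤ (4 : ℝ) ^ dd / 3072 := by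
      refine le_trans ?_ hdatA
      have h0 : 0 ≤ R.Gfr 3 * U ^ 2 * ((4 : ℝ) ^ (N + 1) / 3) := by have := hRj 3; positivity
      exact mul_le_mul_of_nonneg_left (pow_le_pow_left₀ hΛ0 hΛle 2) h0
    nlinarith only [h1, h2]
  exact h R hRj cc U hcc hcle hU hU3 β hβmin hβc μ hμ K hfr _ _ hA3 hK3 L M hLβ hMβ nf hnf hnfN hdatA hdatK nw hnw

end Summit.HubbardSuperconductivity.HubbardSuperconductivity.Theorems.TorusFourierL2

end
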